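import Summits.BirchSwinnertonDyer.BirchSwinnertonDyer.Theorems.Rank2Observatory2DescClCurveCertE3N
import Summits.BirchSwinnertonDyer.BirchSwinnertonDyer.Theorems.Rank2Observatory2DescClRealCurveCertSX
import HarnessLib

/-!
# BirchSwinnertonDyer — rank ≥ 2 observatory: KERNEL-2DESC-CL v3.0 — NODAL LOCAL CONDITIONS on the SPLIT-2 host, totally real case (`…RSN`)

HONEST FRAMING: per-curve certified theorems and census instruments; no claim on BSD in rank ≥ 2.

The consumer of `…ClRealCurveCertSX` (`checkRSCore` + `rank_le_of_checkRSX`): the per-curve checker **`checkRSN`** =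
the core clauses of the landed totally real split-2 checker `checkRS` ∧ the NODAL kernel clauses of
`…ClCurveCertE3N` (records `NodalCert`, Hensel certificates `henselAll`, read on the one-view fractional coordinates
`X_t`, `X_j` of the split-2 record: `nodRootsRS`, `nodTableRS`, `nodalClauseOddRS`, `nodalClauseTwoRS`) ∧ the
survivor count of `admRS ∧ extraNRS` `≤ 2 ^ r`, where `extraNRS U` = «the kernel class vector of `U` lies in the
enumerated exact local image `splitImgOdd ℓ` / `splitImgTwo` at every listed nodal prime».  Soundness
**`rank_le_of_checkRSN`** = `rank_le_of_checkRSX` with the pointwise soundness of `extraNRS` discharged by the landed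
per-point nodal lemmas `uvecOdd_mem_splitImgOdd` / `uvecTwo_mem_splitImgTwo` (`…SplitImageNodal{,Two}`), exactly as
in the landed `…ClCurveCertE3N` / `…ClCurveCertE2RN` (scaling `m = r₁²`).  Row wrappers
`rank_eq_of_certsRSN{,_scaled,_complSq,_plain}`.  Twin of the complex module `…ClCurveCertSN` (kernel helpers carry
the suffix `RS` so that both modules can be imported together).  New declarations only.
Sorry-free; axioms `propext`, `Classical.choice`, `Quot.sound`.
[cite: Cassels1991LecturesEllipticCurves, §15] [cite: CremonaAlgorithms1997, §3.6] [cite: SilvermanAEC2009, VII.2.2, X.1.1]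
[cite: Cohen1993, §6.5] [cite: Marcus2018, Ch. 5, Thm. 38]
-/

set_option linter.dupNamespace false
set_option autoImplicit false

noncomputable section

open scoped Classical NumberField nonZeroDivisors

open Literature.NumberTheory.NumberFields Polynomial Module NumberField IsDedekindDomain Ideal

namespace Summit.BirchSwinnertonDyer.BirchSwinnertonDyer.Rank2Observatory.TwoDescCl

open TwoDescCubic ClFieldCert SplitImage TwoDescPadic

/-! ## Records -/

/-- **Per-curve record with nodal local conditions (split-2 host, totally real case)**: the totally real split-2
record of `…ClRealCurveCertSDefs`, the odd nodal primes and the `2`-adic nodal certificates (field `ℓ` must be `2` there).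
[cite: Cassels1991LecturesEllipticCurves, §15] -/
structure ClCurveCertSRN where
  /-- the totally real split-2 per-curve record -/
  cr : ClCurveCertSR
  /-- odd nodal primes -/
  nod : List NodalCert
  /-- `2`-adic nodal certificates -/
  nod2 : List NodalCert

/-! ## Kernel clauses (computable) -/

section Kernel

/-- The integer stand-ins `X_t(a_i)` of the scaled roots `m₁ e_i`. [folklore] -/
def nodRootsRS (cc : ClCurveCertS) (n : NodalCert) : Fin 3 → ℤ := fun i => evalInt (n.ar i) cc.Xt

/-- The integer table `X_j(a_i)` of the scaled family `m₁ w_j` at the three roots. [folklore] -/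
def nodTableRS (cc : ClCurveCertS) (n : NodalCert) : Fin 3 → Fin (famS cc).length → ℤ :=
  fun i j => evalInt (n.ar i) ((famS cc).get j).X

/-- **Kernel clause of an odd nodal prime**: `ℓ ≠ 2`, three Hensel certificates, `X_t(a_i)` pairwise distinct,
tree precision `nodeDepth + 1 ≤ N`, table entries non-zero of valuation `< N`. [folklore] -/
def nodalClauseOddRS (fc : ClFieldCert) (cc : ClCurveCertS) (n : NodalCert) : Bool :=
  !decide (n.ℓ = 2) && henselAll fc n &&
    decide (∀ i k : Fin 3, i ≠ k → nodRootsRS cc n i ≠ nodRootsRS cc n k) &&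
    decide (nodeDepth n.ℓ (nodRootsRS cc n) + 1 ≤ n.N) &&
    decide (∀ i : Fin 3, ∀ j : Fin (famS cc).length, nodTableRS cc n i j ≠ 0 ∧ valInt n.ℓ (nodTableRS cc n i j) < n.N)

/-- **Kernel clause of a `2`-adic nodal certificate**: `ℓ = 2`, three Hensel certificates, `X_t(a_i)` pairwise
distinct, tree precision `nodeDepth + 4 ≤ N`, table entries non-zero with `v_2 + 3 ≤ N`. [folklore] -/
def nodalClauseTwoRS (fc : ClFieldCert) (cc : ClCurveCertS) (n : NodalCert) : Bool :=
  decide (n.ℓ = 2) && henselAll fc n &&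
    decide (∀ i k : Fin 3, i ≠ k → nodRootsRS cc n i ≠ nodRootsRS cc n k) &&
    decide (nodeDepth 2 (nodRootsRS cc n) + 4 ≤ n.N) &&
    decide (∀ i : Fin 3, ∀ j : Fin (famS cc).length, nodTableRS cc n i j ≠ 0 ∧ valInt 2 (nodTableRS cc n i j) + 3 ≤ n.N)

/-- **The nodal sieve conjunct**: the kernel class vector of `U` lies in the enumerated local image at every listed
prime. [cite: Cassels1991LecturesEllipticCurves, §15] -/
def extraNRS (c : ClCurveCertSRN) (U : Finset (Fin (famS c.cr.cc).length)) : Bool :=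
  (c.nod.all fun n => decide (uvecOdd n.ℓ (nodTableRS c.cr.cc n) U ∈ splitImgOdd n.ℓ (nodRootsRS c.cr.cc n))) &&
    (c.nod2.all fun n => decide (uvecTwo (nodTableRS c.cr.cc n) U ∈ splitImgTwo (nodRootsRS c.cr.cc n)))

variable (G : ClFieldCertRS2) (c : ClCurveCertSRN)

/-- **The totally real split-2 per-curve checker with nodal local conditions for `rank ≤ r`**: the core
clauses of `checkRS`, the nodal kernel clauses, and the count of survivors of `admRS ∧ extraNRS` `≤ 2 ^ r`. Computable; run
by `decide +kernel`. [cite: Cassels1991LecturesEllipticCurves, §15] -/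
def checkRSN (r : ℕ) : Bool :=
  checkRSCore G c.cr && (c.nod.all fun n => nodalClauseOddRS G.toS2.fs.base c.cr.cc n) &&
    (c.nod2.all fun n => nodalClauseTwoRS G.toS2.fs.base c.cr.cc n) &&
    decide (((Finset.univ ×ˢ Finset.univ).filter
      (fun p : Finset (Fin 0) × Finset (Fin (famS c.cr.cc).length) =>
        (admRS G c.cr p.1 p.2 && extraNRS c p.2) = true)).card ≤ 2 ^ r)

end Kernel

/-! ## Soundness -/

section Sound

variable {K : Type*} [Field K] [NumberField K] {θ : K}

/-- **Soundness of the totally real split-2 checker with nodal local conditions: `rank E(ℚ) ≤ r`.**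
[cite: Cassels1991LecturesEllipticCurves, §15] [cite: CremonaAlgorithms1997, §3.6] -/
theorem rank_le_of_checkRSN (r : ℕ) (G : ClFieldCertRS2)
    (hθ : aeval θ (MonicCubic.poly G.toS2.fs.base.a G.toS2.fs.base.b G.toS2.fs.base.c) = 0)
    (h3 : finrank ℚ K = 3) (h2 : G.check2RS = true) (hpr : G.toS2.fs.base.primeList.Forall Nat.Prime)
    (c : ClCurveCertSRN) (hnp : (c.nod.map NodalCert.ℓ).Forall Nat.Prime) (hc : checkRSN G c r = true) :
    ((⟨0, c.cr.cc.A, 0, c.cr.cc.B, c.cr.cc.C⟩ : WeierstrassCurve ℚ)).mordellWeilRank ≤ r := by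
  classical
  unfold checkRSN at hc
  have hcount := of_decide_eq_true (Bool.and_eq_true_iff.mp hc).2
  have h123 := (Bool.and_eq_true_iff.mp hc).1
  have hnod2 := List.all_eq_true.mp (Bool.and_eq_true_iff.mp h123).2
  have hnod := List.all_eq_true.mp (Bool.and_eq_true_iff.mp (Bool.and_eq_true_iff.mp h123).1).2
  have hcore := (Bool.and_eq_true_iff.mp (Bool.and_eq_true_iff.mp h123).1).1
  have hK := G.const_of_check2RS h2
  have hS := G.coreS_of_check2RS h2
  have hR := G.toS2.fs.checkReg_of_coreS hS
  have hirr := G.toS2.fs.base.irreducible_of_reg hR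
  have hm : (G.toS2.r₁ : ℤ) ≠ 0 := Nat.cast_ne_zero.mpr (G.toS2.r₁_pos hK).ne'
  have hmcast : (((G.toS2.r₁ : ℤ) ^ 2 : ℤ) : 𝓞 K) = (G.toS2.m₁ : 𝓞 K) := by
    simp only [ClFieldCertS2.m₁, Nat.cast_pow, Int.cast_pow, Int.cast_natCast]
  refine rank_le_of_checkRSX r G hθ h3 h2 hpr c.cr hcore (extraNRS c) ?_ ?_ hcount
  · -- `extraNRS ∅`: the class vector of `∅` is `0 ∈` every local image
    simp only [extraNRS, Bool.and_eq_true, List.all_eq_true, decide_eq_true_eq]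
    exact ⟨fun n _ => by rw [uvecOdd_empty]; exact zero_mem_splitImgOdd _ _,
      fun n _ => by rw [uvecTwo_empty]; exact zero_mem_splitImgTwo _⟩
  · intro e W he hW hW0 hroot x y hxy hy U hsq
    have he' : (((G.toS2.r₁ : ℤ) ^ 2 : ℤ) : 𝓞 K) * e = lin hθ c.cr.cc.Xt.1 c.cr.cc.Xt.2.1 c.cr.cc.Xt.2.2 := by
      rw [hmcast]; exact he
    have hW' : ∀ j, (((G.toS2.r₁ : ℤ) ^ 2 : ℤ) : 𝓞 K) * W j = lin hθ ((famS c.cr.cc).get j).X.1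
        ((famS c.cr.cc).get j).X.2.1 ((famS c.cr.cc).get j).X.2.2 := fun j => by rw [hmcast]; exact hW j
    simp only [extraNRS, Bool.and_eq_true, List.all_eq_true, decide_eq_true_eq]
    refine ⟨fun n hn => ?_, fun n hn => ?_⟩
    · -- an odd nodal prime
      have hcl := hnod n hn
      simp only [nodalClauseOddRS, henselAll, Bool.and_eq_true, Bool.not_eq_true', decide_eq_false_iff_not,
        decide_eq_true_eq] at hcl
      obtain ⟨⟨⟨⟨hℓ2, ⟨hh0, hh1⟩, hh2⟩, hdist⟩, hdepth⟩, hprec⟩ := hcl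
      have hp : n.ℓ.Prime := List.forall_iff_forall_mem.mp hnp n.ℓ (List.mem_map.mpr ⟨n, hn, rfl⟩)
      haveI : Fact n.ℓ.Prime := ⟨hp⟩
      obtain ⟨R0⟩ := nonempty_rootedPrime_of_henselCheck (θ := θ) hirr hθ h3 hh0
      obtain ⟨R1⟩ := nonempty_rootedPrime_of_henselCheck (θ := θ) hirr hθ h3 hh1
      obtain ⟨R2⟩ := nonempty_rootedPrime_of_henselCheck (θ := θ) hirr hθ h3 hh2
      have hφ : ∀ i : Fin 3, (![R0.φ, R1.φ, R2.φ] : Fin 3 → (K →+* ℚ_[n.ℓ])) i θ =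
          ((![R0.z, R1.z, R2.z] : Fin 3 → ℤ_[n.ℓ]) i : ℚ_[n.ℓ]) := by
        intro i; fin_cases i
        exacts [R0.φ_theta, R1.φ_theta, R2.φ_theta]
      have hclose : ∀ i : Fin 3, ‖(![R0.z, R1.z, R2.z] : Fin 3 → ℤ_[n.ℓ]) i - (n.ar i : ℤ_[n.ℓ])‖ ≤
          (n.ℓ : ℝ) ^ (-(n.N : ℤ)) := by
        intro i; fin_cases i
        exacts [R0.close, R1.close, R2.close]
      exact uvecOdd_mem_splitImgOdd (SqClassOdd.sqClassMapOdd n.ℓ) hℓ2 hθ hφ hclose hm he' hroot hW' hW0 hxy hy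
        hsq hdist hdepth hprec
    · -- a `2`-adic nodal certificate
      have hcl := hnod2 n hn
      simp only [nodalClauseTwoRS, henselAll, Bool.and_eq_true, decide_eq_true_eq] at hcl
      obtain ⟨⟨⟨⟨hℓ, ⟨hh0, hh1⟩, hh2⟩, hdist⟩, hdepth⟩, hprec⟩ := hcl
      rw [hℓ] at hh0 hh1 hh2
      obtain ⟨R0⟩ := nonempty_rootedPrime_of_henselCheck (θ := θ) hirr hθ h3 hh0
      obtain ⟨R1⟩ := nonempty_rootedPrime_of_henselCheck (θ := θ) hirr hθ h3 hh1
      obtain ⟨R2⟩ := nonempty_rootedPrime_of_henselCheck (θ := θ) hirr hθ h3 hh2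
      have hφ : ∀ i : Fin 3, (![R0.φ, R1.φ, R2.φ] : Fin 3 → (K →+* ℚ_[2])) i θ =
          ((![R0.z, R1.z, R2.z] : Fin 3 → ℤ_[2]) i : ℚ_[2]) := by
        intro i; fin_cases i
        exacts [R0.φ_theta, R1.φ_theta, R2.φ_theta]
      have hclose : ∀ i : Fin 3, ‖(![R0.z, R1.z, R2.z] : Fin 3 → ℤ_[2]) i - (n.ar i : ℤ_[2])‖ ≤
          ((2 : ℕ) : ℝ) ^ (-(n.N : ℤ)) := by
        intro i; fin_cases i
        exacts [R0.close, R1.close, R2.close]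
      exact uvecTwo_mem_splitImgTwo SqClassTwo.sqClassMapTwo hθ hφ hclose hm he' hroot hW' hW0 hxy hy hsq hdist
        hdepth hprec

/-- **`rank E(ℚ) = r`** (totally real split-2 field record, nodal local conditions) from the checked records and
a tree lower bound. [cite: CremonaAlgorithms1997, §3.6] -/
theorem rank_eq_of_checkRSN (r : ℕ) (G : ClFieldCertRS2)
    (hθ : aeval θ (MonicCubic.poly G.toS2.fs.base.a G.toS2.fs.base.b G.toS2.fs.base.c) = 0)
    (h3 : finrank ℚ K = 3) (h2 : G.check2RS = true) (hpr : G.toS2.fs.base.primeList.Forall Nat.Prime)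
    (c : ClCurveCertSRN) (hnp : (c.nod.map NodalCert.ℓ).Forall Nat.Prime) (hc : checkRSN G c r = true)
    (hlow : r ≤ (((⟨0, c.cr.cc.A, 0, c.cr.cc.B, c.cr.cc.C⟩ : WeierstrassCurve ℤ)).map
      (Int.castRingHom ℚ)).mordellWeilRank) :
    (((⟨0, c.cr.cc.A, 0, c.cr.cc.B, c.cr.cc.C⟩ : WeierstrassCurve ℤ)).map (Int.castRingHom ℚ)).mordellWeilRank =
      r := by
  have hV : ((⟨0, c.cr.cc.A, 0, c.cr.cc.B, c.cr.cc.C⟩ : WeierstrassCurve ℤ)).map (Int.castRingHom ℚ) =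
      (⟨0, c.cr.cc.A, 0, c.cr.cc.B, c.cr.cc.C⟩ : WeierstrassCurve ℚ) := by
    ext <;> simp [WeierstrassCurve.map]
  refine le_antisymm ?_ hlow
  rw [hV]
  exact rank_le_of_checkRSN r G hθ h3 h2 hpr c hnp hc

end Sound

/-! ## `K`-free wrappers over the model `CubicField a b c` -/

section Rows

/-- **`rank E(ℚ) = r` from the records** (model `(0, A, 0, B, C)`, totally real split-2 host, nodal local
conditions).
[cite: Cassels1991LecturesEllipticCurves, §15] [cite: CremonaAlgorithms1997, §3.6] -/
theorem rank_eq_of_certsRSN (r : ℕ) (G : ClFieldCertRS2) (c : ClCurveCertSRN) (h2 : G.check2RS = true)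
    (hpr : G.toS2.fs.base.primeList.Forall Nat.Prime) (hnp : (c.nod.map NodalCert.ℓ).Forall Nat.Prime)
    (hc : checkRSN G c r = true)
    (hlow : r ≤ (((⟨0, c.cr.cc.A, 0, c.cr.cc.B, c.cr.cc.C⟩ : WeierstrassCurve ℤ)).map
      (Int.castRingHom ℚ)).mordellWeilRank) :
    (((⟨0, c.cr.cc.A, 0, c.cr.cc.B, c.cr.cc.C⟩ : WeierstrassCurve ℤ)).map (Int.castRingHom ℚ)).mordellWeilRank =
      r := by
  haveI : Fact (Irreducible (MonicCubic.polyQ G.toS2.fs.base.a G.toS2.fs.base.b G.toS2.fs.base.c)) :=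
    ⟨G.toS2.fs.base.irreducible_of_reg (G.toS2.fs.checkReg_of_coreS (G.coreS_of_check2RS h2))⟩
  exact rank_eq_of_checkRSN (K := CubicField G.toS2.fs.base.a G.toS2.fs.base.b G.toS2.fs.base.c) r G
    (CubicField.aeval_root _ _ _) (CubicField.finrank_eq _ _ _) h2 hpr c hnp hc hlow

/-- **`rank E(ℚ) = r` for the ORIGINAL model** `(a₁, a₂, a₃, a₄, a₆)` when the records certify its completed-square
model rescaled by `d ≠ 0`. [cite: CremonaAlgorithms1997, §3.6] [cite: SilvermanAEC2009, III.3.1(b)] -/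
theorem rank_eq_of_certsRSN_scaled (r : ℕ) (G : ClFieldCertRS2) (c : ClCurveCertSRN) (h2 : G.check2RS = true)
    (hpr : G.toS2.fs.base.primeList.Forall Nat.Prime) (hnp : (c.nod.map NodalCert.ℓ).Forall Nat.Prime)
    (hc : checkRSN G c r = true) (a₁ a₂ a₃ a₄ a₆ d : ℤ) (hd : d ≠ 0)
    (hABC : c.cr.cc.A = d ^ 2 * (a₁ ^ 2 + 4 * a₂) ∧ c.cr.cc.B = d ^ 4 * (8 * (a₁ * a₃ + 2 * a₄)) ∧
      c.cr.cc.C = d ^ 6 * (16 * (a₃ ^ 2 + 4 * a₆)))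
    (hlow : r ≤ (((⟨a₁, a₂, a₃, a₄, a₆⟩ : WeierstrassCurve ℤ)).map (Int.castRingHom ℚ)).mordellWeilRank) :
    (((⟨a₁, a₂, a₃, a₄, a₆⟩ : WeierstrassCurve ℤ)).map (Int.castRingHom ℚ)).mordellWeilRank = r := by
  obtain ⟨hA, hB, hC⟩ := hABC
  rw [mordellWeilRank_complSq_scaled a₁ a₂ a₃ a₄ a₆ d hd, ← hA, ← hB, ← hC] at hlow ⊢
  exact rank_eq_of_certsRSN r G c h2 hpr hnp hc hlow

/-- The plain completed-square shape (`d = 1`). [cite: CremonaAlgorithms1997, §3.6] -/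
theorem rank_eq_of_certsRSN_complSq (r : ℕ) (G : ClFieldCertRS2) (c : ClCurveCertSRN) (h2 : G.check2RS = true)
    (hpr : G.toS2.fs.base.primeList.Forall Nat.Prime) (hnp : (c.nod.map NodalCert.ℓ).Forall Nat.Prime)
    (hc : checkRSN G c r = true) (a₁ a₂ a₃ a₄ a₆ : ℤ)
    (hABC : c.cr.cc.A = a₁ ^ 2 + 4 * a₂ ∧ c.cr.cc.B = 8 * (a₁ * a₃ + 2 * a₄) ∧ c.cr.cc.C = 16 * (a₃ ^ 2 + 4 * a₆))
    (hlow : r ≤ (((⟨a₁, a₂, a₃, a₄, a₆⟩ : WeierstrassCurve ℤ)).map (Int.castRingHom ℚ)).mordellWeilRank) :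
    (((⟨a₁, a₂, a₃, a₄, a₆⟩ : WeierstrassCurve ℤ)).map (Int.castRingHom ℚ)).mordellWeilRank = r :=
  rank_eq_of_certsRSN_scaled r G c h2 hpr hnp hc a₁ a₂ a₃ a₄ a₆ 1 one_ne_zero
    (by obtain ⟨hA, hB, hC⟩ := hABC; exact ⟨by rw [hA]; ring, by rw [hB]; ring, by rw [hC]; ring⟩) hlow

/-- Row plumbing for a plain model `y² = x³ + a₂x² + a₄x + a₆`: the record's cubic IS the curve.
[cite: Cassels1991LecturesEllipticCurves, §15] -/
theorem rank_eq_of_certsRSN_plain (r : ℕ) (G : ClFieldCertRS2) (c : ClCurveCertSRN) (h2 : G.check2RS = true)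
    (hpr : G.toS2.fs.base.primeList.Forall Nat.Prime) (hnp : (c.nod.map NodalCert.ℓ).Forall Nat.Prime)
    (hc : checkRSN G c r = true) (a₂ a₄ a₆ : ℤ) (hABC : c.cr.cc.A = a₂ ∧ c.cr.cc.B = a₄ ∧ c.cr.cc.C = a₆)
    (hlow : r ≤ (((⟨0, a₂, 0, a₄, a₆⟩ : WeierstrassCurve ℤ)).map (Int.castRingHom ℚ)).mordellWeilRank) :
    (((⟨0, a₂, 0, a₄, a₆⟩ : WeierstrassCurve ℤ)).map (Int.castRingHom ℚ)).mordellWeilRank = r := by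
  obtain ⟨rfl, rfl, rfl⟩ := hABC
  exact rank_eq_of_certsRSN r G c h2 hpr hnp hc hlow

end Rows

end Summit.BirchSwinnertonDyer.BirchSwinnertonDyer.Rank2Observatory.TwoDescCl

end
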